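import Mathlib
import Literature.NumberTheory.LFunctions.RHInvZetaBound
import HarnessLib

/-!
# Second moments from a zero-free symmetrised Laplace transform (Borel–Carathéodory)

Support file for crux `CovarianceBound` (stmt-QuantumFields-8780), line `Sketch`, route
`QuantumFields/YangMills/ConvexGribovBody`: the registered stub `stub_symmBorelCaratheodory`.

For a bounded real random variable `X`, `|X| ≤ M`, on a probability space, whose symmetrised
Laplace transform `f(z) = E e^{zX} + E e^{-zX} = 2 E cosh(zX)` has no zero on the disc
`‖z‖ < 2R`, we prove `E X² ≤ 8 M / R` (so the registered `∃ κ > 0, …` holds with `κ = 8`).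

Proof. `F = f/2 = (complexMGF X P + complexMGF (-X) P)/2` is entire (Mathlib's
`ProbabilityTheory.complexMGF` API; `X` bounded makes `integrableExpSet X P = univ`), with
`F(0) = 1`, `F'(0) = (E X - E X)/2 = 0`, `F''(0) = E X²` and `‖F(z)‖ ≤ e^{‖z‖ M} ≤ e^{2RM}` on the
disc. On the zero-free disc `‖z‖ < 2R` it has a holomorphic logarithm `L` with `L(0) = 0`
(`Literature.NumberTheory.LFunctions.InvZetaRH.exists_log_of_ball`), whose real part is
`log ‖F‖ ≤ 2RM`; Borel–Carathéodory (`Complex.borelCaratheodory_zero`) gives `‖L(z)‖ ≤ 4RM` on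
`‖z‖ = R`, Cauchy's estimate (`Complex.norm_iteratedDeriv_le_of_forall_mem_sphere_norm_le`) gives
`‖L''(0)‖ ≤ 2 · 4RM / R² = 8M/R`, and `L'' (0) = F''(0)/F(0) - (F'(0)/F(0))² = E X²`.

Nothing here is specific to lattice gauge theory; the file does not import the line's `Defs`.
-/

set_option autoImplicit false

noncomputable section

namespace Summit.QuantumFields.YangMills.Cruxes.CovarianceBound.SupportWindow

open scoped Topology
open Filter Set MeasureTheory ProbabilityTheory Metric

/-! ### The complex-analysis engine -/

/-- **Borel–Carathéodory + Cauchy for a zero-free normalised holomorphic function.**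
If `F` is holomorphic and zero-free on the disc `‖z‖ < ρ`, with `F 0 = 1`, `F' 0 = 0` and
`‖F z‖ ≤ e^B` there (`B > 0`), then `‖F'' 0‖ ≤ 16 B / ρ²`: take the holomorphic logarithm `L`,
`L 0 = 0`, bound `‖L‖ ≤ 2B` on the circle of radius `ρ/2` by Borel–Carathéodory, apply Cauchy's
estimate to `L''(0) = F''(0)`. -/
private theorem norm_deriv_deriv_le_of_zeroFree {F : ℂ → ℂ} {ρ B : ℝ} (hρ : 0 < ρ)
    (hB : 0 < B) (hF : DifferentiableOn ℂ F (ball 0 ρ)) (h0 : F 0 = 1) (h1 : deriv F 0 = 0)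
    (hne : ∀ z ∈ ball (0 : ℂ) ρ, F z ≠ 0) (hbd : ∀ z ∈ ball (0 : ℂ) ρ, ‖F z‖ ≤ Real.exp B) :
    ‖deriv (deriv F) 0‖ ≤ 16 * B / ρ ^ 2 := by
  obtain ⟨L, hLd, hL0, hLder, hexp⟩ :=
    Literature.NumberTheory.LFunctions.InvZetaRH.exists_log_of_ball hρ hF hne
  rw [h0, Complex.log_one] at hL0
  -- the real part of `L` is `log ‖F‖ ≤ B`
  have hre : MapsTo L (ball (0 : ℂ) ρ) {w | w.re ≤ B} := by
    intro z hz
    have h := hbd z hz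
    rw [← hexp z hz, Complex.norm_exp] at h
    exact Real.exp_le_exp.mp h
  -- Borel–Carathéodory on the circle of radius `ρ / 2`
  have hBC : ∀ z ∈ sphere (0 : ℂ) (ρ / 2), ‖L z‖ ≤ 2 * B := by
    intro z hz
    have hzn : ‖z‖ = ρ / 2 := by simpa using hz
    have hzb : z ∈ ball (0 : ℂ) ρ := by
      rw [mem_ball_zero_iff, hzn]; linarith
    have key := Complex.borelCaratheodory_zero hB hLd hre hρ hzb hL0
    rw [hzn] at key
    calc ‖L z‖ ≤ 2 * B * (ρ / 2) / (ρ - ρ / 2) := key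
      _ = 2 * B * (ρ / 2) / (ρ / 2) := by rw [show ρ - ρ / 2 = ρ / 2 by ring]
      _ = 2 * B := mul_div_cancel_right₀ _ (half_pos hρ).ne'
  -- Cauchy's estimate for the second derivative of `L` at `0`
  have hLdc : DiffContOnCl ℂ L (ball (0 : ℂ) (ρ / 2)) :=
    hLd.diffContOnCl_ball (closedBall_subset_ball (by linarith))
  have hC := Complex.norm_iteratedDeriv_le_of_forall_mem_sphere_norm_le 2 (half_pos hρ) hLdc hBC
  -- `L'' 0 = F'' 0`
  have h0mem : (0 : ℂ) ∈ ball (0 : ℂ) ρ := mem_ball_self hρ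
  have hkey : iteratedDeriv 2 L 0 = deriv (deriv F) 0 := by
    rw [iteratedDeriv_succ, iteratedDeriv_one]
    have hev : deriv L =ᶠ[𝓝 0] fun z => deriv F z / F z := by
      filter_upwards [isOpen_ball.mem_nhds h0mem] with z hz using (hLder z hz).deriv
    rw [hev.deriv_eq]
    have hFat : HasDerivAt F (deriv F 0) 0 :=
      (hF.differentiableAt (isOpen_ball.mem_nhds h0mem)).hasDerivAt
    have hF'at : HasDerivAt (deriv F) (deriv (deriv F) 0) 0 :=
      ((hF.deriv isOpen_ball).differentiableAt (isOpen_ball.mem_nhds h0mem)).hasDerivAt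
    have hq : HasDerivAt (fun z => deriv F z / F z)
        ((deriv (deriv F) 0 * F 0 - deriv F 0 * deriv F 0) / F 0 ^ 2) 0 :=
      hF'at.div hFat (by rw [h0]; exact one_ne_zero)
    rw [hq.deriv, h0, h1]
    simp
  calc ‖deriv (deriv F) 0‖ = ‖iteratedDeriv 2 L 0‖ := by rw [hkey]
    _ ≤ (2 : ℕ).factorial * (2 * B) / (ρ / 2) ^ 2 := hC
    _ = 16 * B / ρ ^ 2 := by
      simp only [Nat.factorial, Nat.succ_eq_add_one, mul_one]
      field_simp
      ring

/-! ### The symmetrised Laplace transform of a bounded random variable -/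

section Bounded

variable {Ω : Type} [MeasurableSpace Ω] {P : Measure Ω} [IsProbabilityMeasure P]
  {Y : Ω → ℝ} {M : ℝ}

/-- For a bounded measurable `Y`, `e^{tY}` is integrable for every real `t`: the whole plane is
the holomorphy strip of `complexMGF Y P`. -/
private theorem re_mem_interior_integrableExpSet (hY : Measurable Y) (hb : ∀ ω, |Y ω| ≤ M)
    (z : ℂ) : z.re ∈ interior (integrableExpSet Y P) := by
  have h : integrableExpSet Y P = Set.univ := by
    refine Set.eq_univ_of_forall fun t => ?_
    exact integrable_exp_mul_of_mem_Icc (a := -M) (b := M) hY.aemeasurable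
      (ae_of_all _ fun ω => Set.mem_Icc.mpr (abs_le.mp (hb ω)))
  simp [h]

/-- `‖E e^{zY}‖ ≤ e^{‖z‖ M}` for `|Y| ≤ M` on a probability space. -/
private theorem norm_complexMGF_le_exp (hY : Measurable Y) (hb : ∀ ω, |Y ω| ≤ M) (z : ℂ) :
    ‖complexMGF Y P z‖ ≤ Real.exp (‖z‖ * M) := by
  refine norm_complexMGF_le_mgf.trans ?_
  calc mgf Y P z.re = ∫ ω, Real.exp (z.re * Y ω) ∂P := rfl
    _ ≤ ∫ _ω, Real.exp (‖z‖ * M) ∂P := by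
        refine integral_mono ?_ (integrable_const _) fun ω => ?_
        · exact integrable_exp_mul_of_mem_Icc (a := -M) (b := M) hY.aemeasurable
            (ae_of_all _ fun ω => Set.mem_Icc.mpr (abs_le.mp (hb ω)))
        · refine Real.exp_le_exp.mpr ?_
          calc z.re * Y ω ≤ |z.re * Y ω| := le_abs_self _
            _ = |z.re| * |Y ω| := abs_mul _ _
            _ ≤ ‖z‖ * M :=
                mul_le_mul (Complex.abs_re_le_norm z) (hb ω) (abs_nonneg _) (norm_nonneg _)
    _ = Real.exp (‖z‖ * M) := by simp

/-- `E e^{0·Y} = 1`. -/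
private theorem complexMGF_apply_zero : complexMGF Y P 0 = 1 := by
  simp [complexMGF]

/-- `(d/dz) E e^{zY} |_{z=0} = E Y` for bounded measurable `Y`. -/
private theorem deriv_complexMGF_zero (hY : Measurable Y) (hb : ∀ ω, |Y ω| ≤ M) :
    deriv (complexMGF Y P) 0 = ∫ ω, (Y ω : ℂ) ∂P := by
  rw [(hasDerivAt_complexMGF (re_mem_interior_integrableExpSet hY hb (0 : ℂ))).deriv]
  simp

/-- `(d/dz)² E e^{zY} |_{z=0} = E Y²` for bounded measurable `Y` (as a derivative of `deriv`). -/
private theorem hasDerivAt_deriv_complexMGF_zero (hY : Measurable Y) (hb : ∀ ω, |Y ω| ≤ M) :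
    HasDerivAt (deriv (complexMGF Y P)) (∫ ω, (Y ω : ℂ) ^ 2 ∂P) 0 := by
  have h := hasDerivAt_iteratedDeriv_complexMGF
    (re_mem_interior_integrableExpSet (P := P) hY hb (0 : ℂ)) 1
  rw [iteratedDeriv_one] at h
  refine h.congr_deriv ?_
  congr 1
  funext ω
  simp

end Bounded

/-! ### The registered stub -/

/-- **Stub `stub_symmBorelCaratheodory`** (classical complex analysis, `κ = 8`): for a bounded real
random variable `X`, `|X| ≤ M`, on a probability space, whose symmetrised Laplace transform
`E e^{zX} + E e^{-zX}` has no zero on `‖z‖ < 2R`, one has `E X² ≤ κ M / R`. Holomorphic logarithm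
of `F = (E e^{zX} + E e^{-zX})/2` on the disc, Borel–Carathéodory, Cauchy's estimate, and
`(log F)''(0) = E X²` (`norm_deriv_deriv_le_of_zeroFree`). -/
theorem stub_symmBorelCaratheodory :
    ∃ κ : ℝ, 0 < κ ∧ ∀ (Ω : Type) [MeasurableSpace Ω] (P : Measure Ω) [IsProbabilityMeasure P]
    (X : Ω → ℝ) (M R : ℝ), 0 < M → 0 < R → Measurable X → (∀ ω, |X ω| ≤ M) →
    (∀ z : ℂ, ‖z‖ < 2 * R →
      (∫ ω, Complex.exp (z * (X ω : ℂ)) ∂P) + (∫ ω, Complex.exp (-(z * (X ω : ℂ))) ∂P) ≠ 0) →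
    ∫ ω, (X ω) ^ 2 ∂P ≤ κ * M / R := by
  refine ⟨8, by norm_num, ?_⟩
  intro Ω _ P _ X M R hM hR hX hb hzero
  -- `-X` is bounded and measurable as well
  have hXn : Measurable (fun ω => -X ω) := hX.neg
  have hbn : ∀ ω, |(-X ω)| ≤ M := fun ω => by rw [abs_neg]; exact hb ω
  -- the symmetrised transform `F = (E e^{zX} + E e^{-zX}) / 2`
  set F : ℂ → ℂ := fun z => (complexMGF X P z + complexMGF (fun ω => -X ω) P z) / 2 with hF
  have hφd : ∀ z, HasDerivAt (complexMGF X P) (deriv (complexMGF X P) z) z := fun z =>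
    (hasDerivAt_complexMGF (re_mem_interior_integrableExpSet hX hb z)).differentiableAt.hasDerivAt
  have hψd : ∀ z, HasDerivAt (complexMGF (fun ω => -X ω) P)
      (deriv (complexMGF (fun ω => -X ω) P) z) z := fun z =>
    (hasDerivAt_complexMGF
      (re_mem_interior_integrableExpSet hXn hbn z)).differentiableAt.hasDerivAt
  have hFd : ∀ z, HasDerivAt F
      ((deriv (complexMGF X P) z + deriv (complexMGF (fun ω => -X ω) P) z) / 2) z :=
    fun z => ((hφd z).add (hψd z)).div_const 2
  have hFderiv : deriv F =
      fun z => (deriv (complexMGF X P) z + deriv (complexMGF (fun ω => -X ω) P) z) / 2 :=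
    funext fun z => (hFd z).deriv
  have hFdiff : Differentiable ℂ F := fun z => (hFd z).differentiableAt
  have hF0 : F 0 = 1 := by
    simp only [hF, complexMGF_apply_zero]
    norm_num
  have hF1 : deriv F 0 = 0 := by
    rw [hFderiv]
    simp only [deriv_complexMGF_zero hX hb, deriv_complexMGF_zero hXn hbn]
    push_cast
    rw [integral_neg]
    ring
  have hF2 : HasDerivAt (deriv F) (((∫ ω, (X ω) ^ 2 ∂P : ℝ) : ℂ)) 0 := by
    rw [hFderiv]
    have h := ((hasDerivAt_deriv_complexMGF_zero (P := P) hX hb).add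
      (hasDerivAt_deriv_complexMGF_zero (P := P) hXn hbn)).div_const 2
    refine h.congr_deriv ?_
    rw [← integral_complex_ofReal]
    push_cast
    simp only [neg_sq]
    ring
  have hF2' : deriv (deriv F) 0 = ((∫ ω, (X ω) ^ 2 ∂P : ℝ) : ℂ) := hF2.deriv
  -- zero-freeness on the disc of radius `2R` is the hypothesis
  have hne : ∀ z ∈ ball (0 : ℂ) (2 * R), F z ≠ 0 := by
    intro z hz
    have h := hzero z (mem_ball_zero_iff.mp hz)
    have hsum : complexMGF X P z + complexMGF (fun ω => -X ω) P z =
        (∫ ω, Complex.exp (z * (X ω : ℂ)) ∂P) + ∫ ω, Complex.exp (-(z * (X ω : ℂ))) ∂P := by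
      simp [complexMGF, mul_neg]
    simp only [hF]
    rw [hsum]
    exact div_ne_zero h two_ne_zero
  -- the a-priori bound `‖F z‖ ≤ e^{‖z‖M} ≤ e^{2RM}` on the disc
  have hbd : ∀ z ∈ ball (0 : ℂ) (2 * R), ‖F z‖ ≤ Real.exp (2 * R * M) := by
    intro z hz
    have hz' : ‖z‖ < 2 * R := mem_ball_zero_iff.mp hz
    have h1 := norm_complexMGF_le_exp (P := P) hX hb z
    have h2 := norm_complexMGF_le_exp (P := P) hXn hbn z
    have h3 : Real.exp (‖z‖ * M) ≤ Real.exp (2 * R * M) :=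
      Real.exp_le_exp.mpr (by nlinarith [norm_nonneg z])
    calc ‖F z‖ = ‖complexMGF X P z + complexMGF (fun ω => -X ω) P z‖ / 2 := by
          simp [hF]
      _ ≤ (‖complexMGF X P z‖ + ‖complexMGF (fun ω => -X ω) P z‖) / 2 := by
          gcongr; exact norm_add_le _ _
      _ ≤ Real.exp (2 * R * M) := by linarith
  have key := norm_deriv_deriv_le_of_zeroFree (by positivity : (0 : ℝ) < 2 * R)
    (by positivity : (0 : ℝ) < 2 * R * M) hFdiff.differentiableOn hF0 hF1 hne hbd
  rw [hF2', Complex.norm_real, Real.norm_eq_abs] at key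
  calc ∫ ω, (X ω) ^ 2 ∂P ≤ |∫ ω, (X ω) ^ 2 ∂P| := le_abs_self _
    _ ≤ 16 * (2 * R * M) / (2 * R) ^ 2 := key
    _ = 8 * M / R := by
      field_simp
      ring

end Summit.QuantumFields.YangMills.Cruxes.CovarianceBound.SupportWindow

end
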